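import Summits.Ventures.PercRepro.C041FourExitZone
import Summits.Ventures.PercRepro.C041TwoExitCount

/-!
# ROW C-041 — THE FOUR-EXIT ATTACHMENT: the anchor classes as conditions on the quintuple (p6, gen 31; groundwork
for r = 4, step (2) of the recipe in P6-TWOEXIT-LEAN.md §6 addendum 2)

A state of `glue4` is a quintuple — a colouring `ω` of `Z₁` and the states of `Z'`, `Z`, `Z''`, `Z'''`
(`stateEquiv4`); the six anchor classes `(c1, c2, k)` are the conditions `fibCond4` on the quintuple
(`mem_Fset_iff4` … `mem_IBset_iff4`), and the fibre of a class over a colouring is `fib4`.  The 52 fibre counts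
(the status patterns of four exits, `genr.py 4`) and the assembly are the successor's.
-/

namespace PercRepro

namespace ZoneZ

namespace TwoExit

open ZoneData Pendant AnchorGlue Finset

variable {V₁ E₁ U₁ U₂ V E T₁ T₂ V' E' T₁' T₂' V'' E'' T₁'' T₂'' V''' E''' T₁''' T₂''' : Type}
variable (Z₁ : ZoneData V₁ E₁ U₁ U₂) (u u' u'' u''' : V₁) (Z : ZoneData V E T₁ T₂) (a : V)
  (Z' : ZoneData V' E' T₁' T₂') (a' : V') (Z'' : ZoneData V'' E'' T₁'' T₂'') (a'' : V'')
  (Z''' : ZoneData V''' E''' T₁''' T₂''') (a''' : V''') (a₁ : V₁)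

/-- The states of the four-exit attachment: a colouring of `Z₁` and the states of `Z'`, `Z`, `Z''`, `Z'''`. -/
def stateEquiv4 :
    State ((((E₁ ⊕ E') ⊕ E) ⊕ E'') ⊕ E''') (((T₁' ⊕ T₁) ⊕ T₁'') ⊕ T₁''') (((T₂' ⊕ T₂) ⊕ T₂'') ⊕ T₂''') ≃
      (E₁ → Bool) × State E' T₁' T₂' × State E T₁ T₂ × State E'' T₁'' T₂'' × State E''' T₁''' T₂''' where
  toFun σ := (col₁₄ σ, st'₄ σ, st₄ σ, st''₄ σ, st'''₄ σ)
  invFun p := (Sum.elim (Sum.elim (Sum.elim (Sum.elim p.1 p.2.1.1) p.2.2.1.1) p.2.2.2.1.1) p.2.2.2.2.1,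
    Sum.elim (Sum.elim (Sum.elim p.2.1.2.1 p.2.2.1.2.1) p.2.2.2.1.2.1) p.2.2.2.2.2.1,
    Sum.elim (Sum.elim (Sum.elim p.2.1.2.2 p.2.2.1.2.2) p.2.2.2.1.2.2) p.2.2.2.2.2.2)
  left_inv σ := by
    obtain ⟨c, m₁, m₂⟩ := σ
    refine Prod.ext ?_ (Prod.ext ?_ ?_)
    · funext e
      rcases e with (((e | e) | e) | e) | e <;> rfl
    · funext t
      rcases t with ((t | t) | t) | t <;> rfl
    · funext t
      rcases t with ((t | t) | t) | t <;> rfl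
  right_inv p := by
    obtain ⟨ω, ⟨c', m₁', m₂'⟩, ⟨c, m₁, m₂⟩, ⟨c'', m₁'', m₂''⟩, ⟨c''', m₁''', m₂'''⟩⟩ := p
    rfl

/-- The equivalence, applied. -/
theorem stateEquiv4_apply
    (σ : State ((((E₁ ⊕ E') ⊕ E) ⊕ E'') ⊕ E''') (((T₁' ⊕ T₁) ⊕ T₁'') ⊕ T₁''') (((T₂' ⊕ T₂) ⊕ T₂'') ⊕ T₂''')) :
    stateEquiv4 σ = (col₁₄ σ, st'₄ σ, st₄ σ, st''₄ σ, st'''₄ σ) := rfl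

/-- The condition on a colouring `ω` of `Z₁` and states `τ'`, `τ`, `τ''`, `τ'''` for the corresponding state of
the four-exit attachment to lie in the anchor class `(c1, c2, k)` (`C041FourExitZone`). -/
def fibCond4 (ω : E₁ → Bool) (c1 c2 k : Bool) (τ' : State E' T₁' T₂') (τ : State E T₁ T₂)
    (τ'' : State E'' T₁'' T₂'') (τ''' : State E''' T₁''' T₂''') : Prop :=
  Z'.adm τ' ∧ Z.adm τ ∧ Z''.adm τ'' ∧ Z'''.adm τ''' ∧
    ¬ (((a' ∈ Z'.D τ' ∧ Z₁.Mg u u' ω) ∨ a ∈ Z.D τ) ∧ ((a' ∈ Z'.D2 τ' ∧ Z₁.Mg u u' ω) ∨ a ∈ Z.D2 τ)) ∧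
    ¬ (((a' ∈ Z'.D τ' ∧ Z₁.Mg u'' u' ω) ∨ (a ∈ Z.D τ ∧ Z₁.Mg u'' u ω) ∨ a'' ∈ Z''.D τ'') ∧
      ((a' ∈ Z'.D2 τ' ∧ Z₁.Mg u'' u' ω) ∨ (a ∈ Z.D2 τ ∧ Z₁.Mg u'' u ω) ∨ a'' ∈ Z''.D2 τ'')) ∧
    ¬ (((a' ∈ Z'.D τ' ∧ Z₁.Mg u''' u' ω) ∨ (a ∈ Z.D τ ∧ Z₁.Mg u''' u ω) ∨ (a'' ∈ Z''.D τ'' ∧ Z₁.Mg u''' u'' ω) ∨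
        a''' ∈ Z'''.D τ''') ∧
      ((a' ∈ Z'.D2 τ' ∧ Z₁.Mg u''' u' ω) ∨ (a ∈ Z.D2 τ ∧ Z₁.Mg u''' u ω) ∨ (a'' ∈ Z''.D2 τ'' ∧ Z₁.Mg u''' u'' ω) ∨
        a''' ∈ Z'''.D2 τ''')) ∧
    (c1 = true → ¬ ((a' ∈ Z'.D τ' ∧ Z₁.Mg a₁ u' ω) ∨ (a ∈ Z.D τ ∧ Z₁.Mg a₁ u ω) ∨
      (a'' ∈ Z''.D τ'' ∧ Z₁.Mg a₁ u'' ω) ∨ (a''' ∈ Z'''.D τ''' ∧ Z₁.Mg a₁ u''' ω))) ∧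
    (c2 = true → ¬ ((a' ∈ Z'.D2 τ' ∧ Z₁.Mg a₁ u' ω) ∨ (a ∈ Z.D2 τ ∧ Z₁.Mg a₁ u ω) ∨
      (a'' ∈ Z''.D2 τ'' ∧ Z₁.Mg a₁ u'' ω) ∨ (a''' ∈ Z'''.D2 τ''' ∧ Z₁.Mg a₁ u''' ω))) ∧
    (k = true → ((Z₁.Rd a₁ u' ω → Z'.blueK {a'} τ') ∧ (Z₁.Rd a₁ u ω → Z.blueK {a} τ) ∧
      (Z₁.Rd a₁ u'' ω → Z''.blueK {a''} τ'') ∧ (Z₁.Rd a₁ u''' ω → Z'''.blueK {a'''} τ''')))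

section Counts

variable [Fintype E₁] [DecidableEq E₁] [Fintype E] [DecidableEq E] [Fintype T₁] [DecidableEq T₁]
  [Fintype T₂] [DecidableEq T₂] [Fintype E'] [DecidableEq E'] [Fintype T₁'] [DecidableEq T₁']
  [Fintype T₂'] [DecidableEq T₂'] [Fintype E''] [DecidableEq E''] [Fintype T₁''] [DecidableEq T₁'']
  [Fintype T₂''] [DecidableEq T₂''] [Fintype E'''] [DecidableEq E'''] [Fintype T₁'''] [DecidableEq T₁''']
  [Fintype T₂'''] [DecidableEq T₂''']

variable (σ : State ((((E₁ ⊕ E') ⊕ E) ⊕ E'') ⊕ E''') (((T₁' ⊕ T₁) ⊕ T₁'') ⊕ T₁''') (((T₂' ⊕ T₂) ⊕ T₂'') ⊕ T₂'''))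

/-- `F`: the class `(T, T, F)`. -/
theorem mem_Fset_iff4 :
    σ ∈ (glue4 Z₁ u u' u'' u''' Z a Z' a' Z'' a'' Z''' a''').Fset (Sum.inl (Sum.inl (Sum.inl (Sum.inl a₁)))) ↔
      fibCond4 Z₁ u u' u'' u''' Z a Z' a' Z'' a'' Z''' a''' a₁ (col₁₄ σ) true true false (st'₄ σ) (st₄ σ)
        (st''₄ σ) (st'''₄ σ) := by
  rw [mem_Fset, adm₄_iff, anchor₄_mem_D_iff, anchor₄_mem_D2_iff]
  simp only [fibCond4, Bool.false_eq_true, false_implies, and_true, true_implies, and_assoc]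

/-- `F + T₁`: the class `(F, T, F)`. -/
theorem mem_FAset_iff4 :
    σ ∈ (glue4 Z₁ u u' u'' u''' Z a Z' a' Z'' a'' Z''' a''').FAset (Sum.inl (Sum.inl (Sum.inl (Sum.inl a₁)))) ↔
      fibCond4 Z₁ u u' u'' u''' Z a Z' a' Z'' a'' Z''' a''' a₁ (col₁₄ σ) false true false (st'₄ σ) (st₄ σ)
        (st''₄ σ) (st'''₄ σ) := by
  rw [mem_FAset, adm₄_iff, anchor₄_mem_D2_iff]
  simp only [fibCond4, Bool.false_eq_true, false_implies, and_true, true_implies, true_and, and_assoc]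

/-- `F + T₂`: the class `(T, F, F)`. -/
theorem mem_FBset_iff4 :
    σ ∈ (glue4 Z₁ u u' u'' u''' Z a Z' a' Z'' a'' Z''' a''').FBset (Sum.inl (Sum.inl (Sum.inl (Sum.inl a₁)))) ↔
      fibCond4 Z₁ u u' u'' u''' Z a Z' a' Z'' a'' Z''' a''' a₁ (col₁₄ σ) true false false (st'₄ σ) (st₄ σ)
        (st''₄ σ) (st'''₄ σ) := by
  rw [mem_FBset, adm₄_iff, anchor₄_mem_D_iff]
  simp only [fibCond4, Bool.false_eq_true, false_implies, and_true, true_implies, and_assoc]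

/-- `I_F`: the class `(T, T, T)`. -/
theorem mem_IFset_iff4 :
    σ ∈ (glue4 Z₁ u u' u'' u''' Z a Z' a' Z'' a'' Z''' a''').IFset (Sum.inl (Sum.inl (Sum.inl (Sum.inl a₁)))) ↔
      fibCond4 Z₁ u u' u'' u''' Z a Z' a' Z'' a'' Z''' a''' a₁ (col₁₄ σ) true true true (st'₄ σ) (st₄ σ)
        (st''₄ σ) (st'''₄ σ) := by
  rw [mem_IFset, adm₄_iff, anchor₄_mem_D_iff, anchor₄_mem_D2_iff, blueK₄_iff]
  simp only [fibCond4, true_implies, and_assoc]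
  tauto

/-- `I_F + I₁`: the class `(F, T, T)`. -/
theorem mem_IAset_iff4 :
    σ ∈ (glue4 Z₁ u u' u'' u''' Z a Z' a' Z'' a'' Z''' a''').IAset (Sum.inl (Sum.inl (Sum.inl (Sum.inl a₁)))) ↔
      fibCond4 Z₁ u u' u'' u''' Z a Z' a' Z'' a'' Z''' a''' a₁ (col₁₄ σ) false true true (st'₄ σ) (st₄ σ)
        (st''₄ σ) (st'''₄ σ) := by
  rw [mem_IAset, adm₄_iff, anchor₄_mem_D2_iff, blueK₄_iff]
  simp only [fibCond4, Bool.false_eq_true, false_implies, true_implies, true_and, and_assoc]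
  tauto

/-- `I_F + I₂`: the class `(T, F, T)`. -/
theorem mem_IBset_iff4 :
    σ ∈ (glue4 Z₁ u u' u'' u''' Z a Z' a' Z'' a'' Z''' a''').IBset (Sum.inl (Sum.inl (Sum.inl (Sum.inl a₁)))) ↔
      fibCond4 Z₁ u u' u'' u''' Z a Z' a' Z'' a'' Z''' a''' a₁ (col₁₄ σ) true false true (st'₄ σ) (st₄ σ)
        (st''₄ σ) (st'''₄ σ) := by
  rw [mem_IBset, adm₄_iff, anchor₄_mem_D_iff, blueK₄_iff]
  simp only [fibCond4, Bool.false_eq_true, false_implies, true_implies, true_and, and_assoc]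
  tauto

open Classical in
/-- The fibre of the class `(c1, c2, k)` over the colouring `ω`. -/
noncomputable def fib4 (ω : E₁ → Bool) (c1 c2 k : Bool) :
    Finset (State E' T₁' T₂' × State E T₁ T₂ × State E'' T₁'' T₂'' × State E''' T₁''' T₂''') :=
  univ.filter fun p => fibCond4 Z₁ u u' u'' u''' Z a Z' a' Z'' a'' Z''' a''' a₁ ω c1 c2 k p.1 p.2.1 p.2.2.1 p.2.2.2

omit [Fintype E₁] [DecidableEq E₁] in
/-- Membership in a fibre. -/
theorem mem_fib4 (ω : E₁ → Bool) (c1 c2 k : Bool)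
    (p : State E' T₁' T₂' × State E T₁ T₂ × State E'' T₁'' T₂'' × State E''' T₁''' T₂''') :
    p ∈ fib4 Z₁ u u' u'' u''' Z a Z' a' Z'' a'' Z''' a''' a₁ ω c1 c2 k ↔
      fibCond4 Z₁ u u' u'' u''' Z a Z' a' Z'' a'' Z''' a''' a₁ ω c1 c2 k p.1 p.2.1 p.2.2.1 p.2.2.2 := by
  classical
  unfold fib4
  rw [Finset.mem_filter]
  exact and_iff_right (Finset.mem_univ _)

end Counts

end TwoExit

end ZoneZ

end PercRepro
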